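import Summits.QuantumFields.YangMills.Theorems.AllWindowsColdBoxBoxHighLineWickPairCubicCubic
import Summits.QuantumFields.YangMills.Theorems.AllWindowsColdBoxBoxHighLineQuadFormCum3Chart
import Summits.QuantumFields.YangMills.Theorems.AllWindowsColdBoxBoxHighLineEdgeChartWick

/-!
# `ConnectedThreePoint`, ODD part, in the CHART (U5-BLOCKERS §2, lift L2 / ASSEMBLY-U5 §3): one centred pair of coordinates against two
# colour-distinct cubic monomials under `exp(−β vᵀPv) dv`, and the cold-box `gaussAvg` form

Width seat `ym-line-sfw-p2-w3` (g41), cell ym-idea-1; U5 prep, helper-grade.  Companion of ✓`…WickPairCubicCubic` (process level).  The cubic vertices of the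
chart (`c_p^{odd}` / `V₃` via ✓`tripleForm_plaqVar_expansion`) are sums of MONOMIALS `a_{l₀}a_{l₁}a_{l₂}` with pairwise distinct colours, so every
intra-monomial propagator vanishes (colour-diagonal `(hodgeQ H ⊗ₖ 1)⁻¹`, ✓`EdgeChartGaussian.kronecker_one_inv_apply`); this is the monomial form the U5 assembler
multiplies by the expansion coefficients and by `Λ_T(e_b)Λ_T(e_{b'})` (the centred `linCurvSq_T`).

* `WickPairCubic.integral_wick2_mul_three_mul_three` — process level, monomial form: for legs with `C(lᵢ,lⱼ) = 0 = C(mᵢ,mⱼ)` inside each triple,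
  `E[(X_bX_{b'} − C_{bb'})·X_{l₀}X_{l₁}X_{l₂}·X_{m₀}X_{m₁}X_{m₂}]` = the 36 connected pairings (pair legs into different triples, the rest across);
* ★★ `gauss_centredPair_mul_three_mul_three` — the same under `E₀[F] = (∫ F e^{−βvᵀPv})/(∫ e^{−βvᵀPv})` on a finite index type, with `S = (2β)⁻¹·P⁻¹`
  (via the generic transfer ✓`GaussianChartWick.integral_mul_exp_quadForm_eq_integral_legs` + ✓`two_point_legs`);
* ★★ `gaussAvg_centredPair_mul_three_mul_three` — cold box, `gaussAvg β H` letters: legs `l s, m s : LandauFree H × Fin 3` with pairwise distinct colours inside each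
  triple, `S i j = (2β)⁻¹·[i.2 = j.2]·((hodgeQ H)⁻¹) i.1 j.1`.
The U5 assembler's odd×odd term of `f′(0)` is `Σ_{bb'} Λ_T(e_b)Λ_T(e_{b'})[κ_b=κ_{b'}] · Σ_{k,l} cA_k cB_l · (this)`: each surviving pairing is one gradient line
`(GΛ_T)` into the `p₀`-monomial, one into the `p'`-monomial and two propagators `p₀ ↔ p'` — RELATIVE `≲ H³·polylog/β` after the `p'`-sum (the lattice sums are
✓`EdgeSums.edgeTwoCentreSums`); that bookkeeping is NOT in this file.

Tree + Mathlib only; no definitions; standard axioms.  HONEST LABEL: a tool for the RECORDED lift L2 of the NEXT rung U5 (⟨stmt-QuantumFields-24336⟩, UNSTAFFED);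
⟨24004⟩ ⟨24336⟩ remain OPEN; route AllWindowsColdBox is DRAFT; no crux, rung or summit is proved; **the Yang–Mills mass gap is NOT proved by this file; no summit
is proved by a line.**
-/

set_option autoImplicit false

noncomputable section

open MeasureTheory ProbabilityTheory Matrix Finset
open scoped Kronecker
open Literature.Probability.Distributions.GaussianWick
open Summit.QuantumFields.YangMills.Theorems.AllWindowsColdBox.CubicChaos (integral_mul_four integral_prod_six)

namespace Summit.QuantumFields.YangMills.Theorems.AllWindowsColdBoxBoxHighLine

namespace WickPairCubic

variable {T Ω : Type*} {mΩ : MeasurableSpace Ω} {P : Measure Ω} {X : T → Ω → ℝ}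

/-- **One Wick-ordered pair against two monomials with no intra-monomial line** (process level): the 36 connected pairings. -/
theorem integral_wick2_mul_three_mul_three (hX : IsGaussianProcess X P) (h0 : ∀ s, ∫ ω, X s ω ∂P = 0) (C : T → T → ℝ)
    (hC : ∀ s s', C s s' = ∫ ω, X s ω * X s' ω ∂P) (b b' l₀ l₁ l₂ m₀ m₁ m₂ : T)
    (h01 : C l₀ l₁ = 0) (h02 : C l₀ l₂ = 0) (h12 : C l₁ l₂ = 0) (h01' : C m₀ m₁ = 0) (h02' : C m₀ m₂ = 0) (h12' : C m₁ m₂ = 0) :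
    ∫ ω, (X b ω * X b' ω - C b b') * (X l₀ ω * X l₁ ω * X l₂ ω) * (X m₀ ω * X m₁ ω * X m₂ ω) ∂P =
      (C b l₀ * C b' m₀ + C b m₀ * C b' l₀) * (C l₁ m₁ * C l₂ m₂ + C l₁ m₂ * C l₂ m₁) +
         (C b l₀ * C b' m₁ + C b m₁ * C b' l₀) * (C l₁ m₀ * C l₂ m₂ + C l₁ m₂ * C l₂ m₀) +
         (C b l₀ * C b' m₂ + C b m₂ * C b' l₀) * (C l₁ m₀ * C l₂ m₁ + C l₁ m₁ * C l₂ m₀) +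
         (C b l₁ * C b' m₀ + C b m₀ * C b' l₁) * (C l₀ m₁ * C l₂ m₂ + C l₀ m₂ * C l₂ m₁) +
         (C b l₁ * C b' m₁ + C b m₁ * C b' l₁) * (C l₀ m₀ * C l₂ m₂ + C l₀ m₂ * C l₂ m₀) +
         (C b l₁ * C b' m₂ + C b m₂ * C b' l₁) * (C l₀ m₀ * C l₂ m₁ + C l₀ m₁ * C l₂ m₀) +
         (C b l₂ * C b' m₀ + C b m₀ * C b' l₂) * (C l₀ m₁ * C l₁ m₂ + C l₀ m₂ * C l₁ m₁) +
         (C b l₂ * C b' m₁ + C b m₁ * C b' l₂) * (C l₀ m₀ * C l₁ m₂ + C l₀ m₂ * C l₁ m₀) +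
         (C b l₂ * C b' m₂ + C b m₂ * C b' l₂) * (C l₀ m₀ * C l₁ m₁ + C l₀ m₁ * C l₁ m₀) := by
  have hre : ∀ ω, (X b ω * X b' ω - C b b') * (X l₀ ω * X l₁ ω * X l₂ ω) * (X m₀ ω * X m₁ ω * X m₂ ω) =
      (X b ω * X b' ω - ∫ ω', X b ω' * X b' ω' ∂P) * (X l₀ ω * X l₁ ω * X l₂ ω * X m₀ ω * X m₁ ω * X m₂ ω) := fun ω => by
    rw [hC b b']; ring
  simp_rw [hre]
  rw [integral_wick2_mul_six hX h0]
  simp only [integral_prod_six hX h0, integral_mul_four hX h0, ← hC, h01, h02, h12, h01', h02', h12']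
  ring

end WickPairCubic

open GaussianChartWick

/-! ## In the chart: `exp(−β vᵀPv) dv` on a finite index type -/

section Chart

variable {ι : Type*} [Fintype ι] [DecidableEq ι]

/-- ★★ **One centred pair against two monomials with no intra-monomial propagator, in the chart.**  With `E₀[F] = (∫ F e^{−βvᵀPv})/(∫ e^{−βvᵀPv})`
and `S = (2β)⁻¹·P⁻¹`: if `S` vanishes inside each triple of legs, `E₀[(v_bv_{b'} − E₀[v_bv_{b'}])·v_{l₀}v_{l₁}v_{l₂}·v_{m₀}v_{m₁}v_{m₂}]` = the 36
connected pairings in `S`. -/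
theorem gauss_centredPair_mul_three_mul_three (P : Matrix ι ι ℝ) (hP : P.PosDef) {β : ℝ} (hβ : 0 < β) (S : ι → ι → ℝ)
    (hS : ∀ i j, S i j = (2 * β)⁻¹ * P⁻¹ i j) (b b' l₀ l₁ l₂ m₀ m₁ m₂ : ι)
    (h01 : S l₀ l₁ = 0) (h02 : S l₀ l₂ = 0) (h12 : S l₁ l₂ = 0) (h01' : S m₀ m₁ = 0) (h02' : S m₀ m₂ = 0) (h12' : S m₁ m₂ = 0) :
    (∫ v : ι → ℝ, (v b * v b' - (∫ v : ι → ℝ, v b * v b' * Real.exp (-(β * (v ⬝ᵥ P *ᵥ v)))) /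
          (∫ v : ι → ℝ, Real.exp (-(β * (v ⬝ᵥ P *ᵥ v))))) * (v l₀ * v l₁ * v l₂) * (v m₀ * v m₁ * v m₂) *
        Real.exp (-(β * (v ⬝ᵥ P *ᵥ v)))) / (∫ v : ι → ℝ, Real.exp (-(β * (v ⬝ᵥ P *ᵥ v)))) =
      (S b l₀ * S b' m₀ + S b m₀ * S b' l₀) * (S l₁ m₁ * S l₂ m₂ + S l₁ m₂ * S l₂ m₁) +
         (S b l₀ * S b' m₁ + S b m₁ * S b' l₀) * (S l₁ m₀ * S l₂ m₂ + S l₁ m₂ * S l₂ m₀) +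
         (S b l₀ * S b' m₂ + S b m₂ * S b' l₀) * (S l₁ m₀ * S l₂ m₁ + S l₁ m₁ * S l₂ m₀) +
         (S b l₁ * S b' m₀ + S b m₀ * S b' l₁) * (S l₀ m₁ * S l₂ m₂ + S l₀ m₂ * S l₂ m₁) +
         (S b l₁ * S b' m₁ + S b m₁ * S b' l₁) * (S l₀ m₀ * S l₂ m₂ + S l₀ m₂ * S l₂ m₀) +
         (S b l₁ * S b' m₂ + S b m₂ * S b' l₁) * (S l₀ m₀ * S l₂ m₁ + S l₀ m₁ * S l₂ m₀) +
         (S b l₂ * S b' m₀ + S b m₀ * S b' l₂) * (S l₀ m₁ * S l₁ m₂ + S l₀ m₂ * S l₁ m₁) +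
         (S b l₂ * S b' m₁ + S b m₁ * S b' l₂) * (S l₀ m₀ * S l₁ m₂ + S l₀ m₂ * S l₁ m₀) +
         (S b l₂ * S b' m₂ + S b m₂ * S b' l₂) * (S l₀ m₀ * S l₁ m₁ + S l₀ m₁ * S l₁ m₀) := by
  obtain ⟨R, hRP, hR, htr⟩ := integral_mul_exp_quadForm_eq_integral_legs P hP hβ
  set e := Fintype.equivFin ι with he
  set μ : Measure (Fin (Fintype.card ι) → ℝ) :=
    Measure.pi (fun _ : Fin (Fintype.card ι) => gaussianReal 0 (Real.toNNReal (2 * β)⁻¹)) with hμ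
  set Z : ℝ := Real.sqrt (Real.pi / β) ^ Fintype.card ι / |R.det| with hZ
  have hZpos : 0 < Z := div_pos (pow_pos (Real.sqrt_pos.mpr (div_pos Real.pi_pos hβ)) _) (abs_pos.mpr hR)
  set X : (Fin (Fintype.card ι) → ℝ) → (Fin (Fintype.card ι) → ℝ) → ℝ := fun ℓ u => ℓ ⬝ᵥ (R⁻¹ *ᵥ u) with hX
  have hGP : IsGaussianProcess X μ := isGaussianProcess_legs R β
  have h0 : ∀ ℓ, ∫ u, X ℓ u ∂μ = 0 := integral_leg_eq_zero R β
  set t : ι → (Fin (Fintype.card ι) → ℝ) := fun i => Pi.single (e i) (1 : ℝ) with ht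
  set φ : (Fin (Fintype.card ι) → ℝ) → (ι → ℝ) := fun u i => (R⁻¹ *ᵥ u) (e i) with hφ
  have hXt : ∀ i u, X (t i) u = φ u i := fun i u => by simp only [hX, ht, hφ, single_one_dotProduct]
  set C : (Fin (Fintype.card ι) → ℝ) → (Fin (Fintype.card ι) → ℝ) → ℝ := fun s s' => ∫ u, X s u * X s' u ∂μ with hC
  have hCS : ∀ i j, C (t i) (t j) = S i j := fun i j => by rw [hS]; exact two_point_legs P hβ hRP i j
  have hnorm : ∫ v : ι → ℝ, Real.exp (-(β * (v ⬝ᵥ P *ᵥ v))) = Z := by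
    have h := htr (fun _ => 1)
    simp only [one_mul] at h
    rw [h, integral_const, smul_eq_mul, probReal_univ, one_mul, mul_one]
  have hE : ∀ F : (ι → ℝ) → ℝ, (∫ v : ι → ℝ, F v * Real.exp (-(β * (v ⬝ᵥ P *ᵥ v)))) /
      (∫ v : ι → ℝ, Real.exp (-(β * (v ⬝ᵥ P *ᵥ v)))) = ∫ u, F (φ u) ∂μ := fun F => by
    rw [hnorm, htr F, mul_div_cancel_left₀ _ hZpos.ne']
  have hpair : (∫ v : ι → ℝ, v b * v b' * Real.exp (-(β * (v ⬝ᵥ P *ᵥ v)))) /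
      (∫ v : ι → ℝ, Real.exp (-(β * (v ⬝ᵥ P *ᵥ v)))) = C (t b) (t b') := by
    rw [hE (fun v => v b * v b')]
    simp only [hC, hXt]
  rw [hpair, hE (fun v => (v b * v b' - C (t b) (t b')) * (v l₀ * v l₁ * v l₂) * (v m₀ * v m₁ * v m₂))]
  have key := WickPairCubic.integral_wick2_mul_three_mul_three hGP h0 C (fun _ _ => rfl) (t b) (t b') (t l₀) (t l₁) (t l₂) (t m₀) (t m₁) (t m₂)
    (by rw [hCS]; exact h01) (by rw [hCS]; exact h02) (by rw [hCS]; exact h12) (by rw [hCS]; exact h01') (by rw [hCS]; exact h02')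
    (by rw [hCS]; exact h12')
  simp only [hXt] at key
  rw [key]
  simp only [hCS]

end Chart

/-! ## The cold box: `gaussAvg β H`, colour-distinct legs -/

section Task

open QuadFluct (boxQuadForm_eq_flat)
open LaplaceSandwich (flatten flatten_apply)

/-- Transfer of an integrand of the flattened field against `gaussWeight` to the flat chart. -/
theorem integral_flat_mul_gaussWeight (β : ℝ) (H : ℕ) (F : (LandauFree H × Fin 3 → ℝ) → ℝ) :
    ∫ a : LandauFree H → E3, F (flatten (LandauFree H) a) * gaussWeight β H a =
      ∫ v : LandauFree H × Fin 3 → ℝ, F v * Real.exp (-(β * (v ⬝ᵥ ((hodgeQ H ⊗ₖ (1 : Matrix (Fin 3) (Fin 3) ℝ)) *ᵥ v)))) := by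
  rw [← EdgeChartGaussian.integral_eq_flat]
  refine integral_congr_ae (Filter.Eventually.of_forall fun a => ?_)
  simp only [gaussWeight, boxQuadForm_eq_flat]

/-- `flatten a i = a i.1 i.2`. -/
theorem flatten_apply_pair {H : ℕ} (a : LandauFree H → E3) (i : LandauFree H × Fin 3) : flatten (LandauFree H) a i = a i.1 i.2 := by
  obtain ⟨x, c⟩ := i
  rfl

/-- ★★ **One centred pair of coordinates against two colour-distinct cubic monomials, cold box.**  For legs `l s`, `m s` with pairwise distinct colours
inside each triple, `κ^{gaussAvg β H} = ` the 36 connected pairings in `S i j = (2β)⁻¹·[i.2 = j.2]·(hodgeQ H)⁻¹ i.1 j.1`. -/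
theorem gaussAvg_centredPair_mul_three_mul_three (H : ℕ) {β : ℝ} (hβ : 0 < β) (S : LandauFree H × Fin 3 → LandauFree H × Fin 3 → ℝ)
    (hS : ∀ i j, S i j = (2 * β)⁻¹ * (if i.2 = j.2 then (hodgeQ H)⁻¹ i.1 j.1 else 0)) (b b' l₀ l₁ l₂ m₀ m₁ m₂ : LandauFree H × Fin 3)
    (h01 : l₀.2 ≠ l₁.2) (h02 : l₀.2 ≠ l₂.2) (h12 : l₁.2 ≠ l₂.2) (h01' : m₀.2 ≠ m₁.2) (h02' : m₀.2 ≠ m₂.2) (h12' : m₁.2 ≠ m₂.2) :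
    gaussAvg β H (fun a => (a b.1 b.2 * a b'.1 b'.2 - gaussAvg β H (fun a => a b.1 b.2 * a b'.1 b'.2)) *
        (a l₀.1 l₀.2 * a l₁.1 l₁.2 * a l₂.1 l₂.2) * (a m₀.1 m₀.2 * a m₁.1 m₁.2 * a m₂.1 m₂.2)) =
      (S b l₀ * S b' m₀ + S b m₀ * S b' l₀) * (S l₁ m₁ * S l₂ m₂ + S l₁ m₂ * S l₂ m₁) +
         (S b l₀ * S b' m₁ + S b m₁ * S b' l₀) * (S l₁ m₀ * S l₂ m₂ + S l₁ m₂ * S l₂ m₀) +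
         (S b l₀ * S b' m₂ + S b m₂ * S b' l₀) * (S l₁ m₀ * S l₂ m₁ + S l₁ m₁ * S l₂ m₀) +
         (S b l₁ * S b' m₀ + S b m₀ * S b' l₁) * (S l₀ m₁ * S l₂ m₂ + S l₀ m₂ * S l₂ m₁) +
         (S b l₁ * S b' m₁ + S b m₁ * S b' l₁) * (S l₀ m₀ * S l₂ m₂ + S l₀ m₂ * S l₂ m₀) +
         (S b l₁ * S b' m₂ + S b m₂ * S b' l₁) * (S l₀ m₀ * S l₂ m₁ + S l₀ m₁ * S l₂ m₀) +
         (S b l₂ * S b' m₀ + S b m₀ * S b' l₂) * (S l₀ m₁ * S l₁ m₂ + S l₀ m₂ * S l₁ m₁) +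
         (S b l₂ * S b' m₁ + S b m₁ * S b' l₂) * (S l₀ m₀ * S l₁ m₂ + S l₀ m₂ * S l₁ m₀) +
         (S b l₂ * S b' m₂ + S b m₂ * S b' l₂) * (S l₀ m₀ * S l₁ m₁ + S l₀ m₁ * S l₁ m₀) := by
  set Pm : Matrix (LandauFree H × Fin 3) (LandauFree H × Fin 3) ℝ := hodgeQ H ⊗ₖ (1 : Matrix (Fin 3) (Fin 3) ℝ) with hPdef
  have hP : Pm.PosDef := GaussianChartWick.posDef_kronecker_one _ (hodgeQ_posDef H)
  have hS' : ∀ i j, S i j = (2 * β)⁻¹ * Pm⁻¹ i j := fun i j => by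
    rw [hS, hPdef, EdgeChartGaussian.kronecker_one_inv_apply (hodgeQ H) (hodgeQ_posDef H).det_pos.ne']
  have hzero : ∀ i j : LandauFree H × Fin 3, i.2 ≠ j.2 → S i j = 0 := fun i j hij => by rw [hS, if_neg hij, mul_zero]
  -- move every integral to the flat chart
  have h0 := integral_flat_mul_gaussWeight β H (fun _ => 1)
  simp only [one_mul] at h0
  have h2 : ∫ a : LandauFree H → E3, (fun a : LandauFree H → E3 => a b.1 b.2 * a b'.1 b'.2) a * gaussWeight β H a =
      ∫ v : LandauFree H × Fin 3 → ℝ, v b * v b' * Real.exp (-(β * (v ⬝ᵥ (Pm *ᵥ v)))) := by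
    refine Eq.trans (integral_congr_ae (Filter.Eventually.of_forall fun a => ?_)) (integral_flat_mul_gaussWeight β H (fun v => v b * v b'))
    simp only [flatten_apply_pair]
  unfold gaussAvg
  rw [h2, h0]
  have h8 : ∫ a : LandauFree H → E3, (fun a : LandauFree H → E3 =>
        (a b.1 b.2 * a b'.1 b'.2 - (∫ v : LandauFree H × Fin 3 → ℝ, v b * v b' * Real.exp (-(β * (v ⬝ᵥ (Pm *ᵥ v))))) /
          ∫ v : LandauFree H × Fin 3 → ℝ, Real.exp (-(β * (v ⬝ᵥ (Pm *ᵥ v))))) *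
        (a l₀.1 l₀.2 * a l₁.1 l₁.2 * a l₂.1 l₂.2) * (a m₀.1 m₀.2 * a m₁.1 m₁.2 * a m₂.1 m₂.2)) a * gaussWeight β H a =
      ∫ v : LandauFree H × Fin 3 → ℝ, (v b * v b' - (∫ v : LandauFree H × Fin 3 → ℝ, v b * v b' * Real.exp (-(β * (v ⬝ᵥ (Pm *ᵥ v))))) /
          ∫ v : LandauFree H × Fin 3 → ℝ, Real.exp (-(β * (v ⬝ᵥ (Pm *ᵥ v))))) * (v l₀ * v l₁ * v l₂) * (v m₀ * v m₁ * v m₂) *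
        Real.exp (-(β * (v ⬝ᵥ (Pm *ᵥ v)))) := by
    refine Eq.trans (integral_congr_ae (Filter.Eventually.of_forall fun a => ?_))
      (integral_flat_mul_gaussWeight β H (fun v =>
        (v b * v b' - (∫ v : LandauFree H × Fin 3 → ℝ, v b * v b' * Real.exp (-(β * (v ⬝ᵥ (Pm *ᵥ v))))) /
          ∫ v : LandauFree H × Fin 3 → ℝ, Real.exp (-(β * (v ⬝ᵥ (Pm *ᵥ v))))) * (v l₀ * v l₁ * v l₂) * (v m₀ * v m₁ * v m₂)))
    simp only [flatten_apply_pair]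
  rw [h8]
  exact gauss_centredPair_mul_three_mul_three Pm hP hβ S hS' b b' l₀ l₁ l₂ m₀ m₁ m₂ (hzero _ _ h01) (hzero _ _ h02) (hzero _ _ h12)
    (hzero _ _ h01') (hzero _ _ h02') (hzero _ _ h12')

end Task

end Summit.QuantumFields.YangMills.Theorems.AllWindowsColdBoxBoxHighLine

end
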